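import Literature.Computability.QuantumComplexity.CleanXorWordDesc
import Literature.Computability.QuantumComplexity.CoreDescBlockFP
import Literature.Computability.QuantumComplexity.UniversalExecutor
import HarnessLib

/-!
# The Grover–Rudolph block's abstract word on codes, from its parameters

Topic `Literature/Computability/QuantumComplexity`; stage S3 of the uniformity of the machine sampler of
[Regev2009, Lemma 3.14]. By `GRStageAbstract.map_toAG_blockCircuit` the block abstracts to
`(List.finRange ℓ).flatMap levelA`, level `j` being `P j ++ (W j ++ Pʳ j)`: the placed clean block's word
`P j = progA ((cleanOps e M (j + np) (v j)).map (ClOp.map (relabel (j + np) (dpos j) base)))`, the rotation word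
`W j = oaaWordA (sandwichA had cr (t j) (gops j) [] [flag j]) (reflectA cr asreg hs)` and the reversed placed program's
word `Pʳ j`. This file computes that shape ON CODES from a context supplying the parameters — `ℓ` (unary), `np`,
`base`, `cr` (binary), the suffixes `v j` (strings), the data lengths `j + np + |v j|` (unary), the maps `dpos j`, `t`,
`flag`, the flag programs `gops j` and the kit's wire lists `had`, `asreg`, `hs` — by `CleanXor.placedWordA_codeFP_of` /
`placedRevWordA_codeFP_of` (`CleanXorWordDesc.lean`), `AJLCore.oaaWordA_fp` / `sandwichA_fp` / `reflectA_fp`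
(`CoreDescBlockFP.lean`) and `UExec.flatMapRange`:

* `GRStage.rotWordA_codeFP_of` — the rotation words on codes;
* **`GRStage.levelsA_codeFP_of`** — the whole block word on codes.

What remains for the sampler's concrete Grover–Rudolph kit is to supply `gops j = (grOps kit (ws j) fs).map (ClOp.map
Fin.val)`, `flag j` and the kit's wire lists on codes (the analogue of `CoreDescAbstract.BP` for this kit). Everything is
proved; no named fact is introduced.

## References

* O. Regev, *On lattices, learning with errors, random linear codes, and cryptography*, J. ACM 56(6) (2009), Lemma 3.12
  (proof), Lemma 3.14 (proof) [Regev2009].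
* L. Grover, T. Rudolph, *Creating superpositions that correspond to efficiently integrable probability distributions*,
  arXiv:quant-ph/0208112 (2002), eq. (5) [GroverRudolph2002].
* S. Arora, B. Barak, *Computational Complexity: A Modern Approach*, CUP 2009, §6.2 and proof of Thm. 6.15
  [AroraBarak2009].
-/

noncomputable section

namespace Literature.Computability.QuantumComplexity

open _root_.Computability Complexity Complexity.CodeFP Turing RevSim RevClean AJLCore CleanPlaced

namespace GRStage

variable {σ : Type} {eσ : σ → List Bool} {e : ℕ} {M : TM2ComputableAux Bool Bool}

/-- **The rotation words on codes**: `(c, j) ↦ oaaWordA (sandwichA (had c) (cr c) (t c j) (gops c j) [] [flag c j])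
(reflectA (cr c) (asreg c) (hs c))`. [cite: GroverRudolph2002, eq. (5)] [cite: AroraBarak2009, §6.2 and proof of Thm. 6.15] -/
theorem rotWordA_codeFP_of {cr : σ → ℕ} {t flag : σ → ℕ → ℕ} {gops : σ → ℕ → List (ClOp ℕ)} {had asreg hs : σ → List ℕ}
    (hcr : CodeFP eσ natE cr) (ht : CodeFP (pairE eσ natE) natE (fun q => t q.1 q.2))
    (hflag : CodeFP (pairE eσ natE) natE (fun q => flag q.1 q.2))
    (hgops : CodeFP (pairE eσ natE) (rawE clopE) (fun q => gops q.1 q.2)) (hhad : CodeFP eσ (rawE natE) had)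
    (hasreg : CodeFP eσ (rawE natE) asreg) (hhs : CodeFP eσ (rawE natE) hs) :
    CodeFP (pairE eσ natE) (rawE agE0) (fun q =>
      oaaWordA (sandwichA (had q.1) (cr q.1) (t q.1 q.2) (gops q.1 q.2) [] [flag q.1 q.2]) (reflectA (cr q.1) (asreg q.1) (hs q.1))) := by
  have h6 : CodeFP (pairE eσ natE) (pairE (rawE natE) (rawE natE)) (fun q => (([] : List ℕ), [flag q.1 q.2])) :=
    (const _ ([] : List ℕ)).pair ((rawSingleton natE).comp hflag)
  have hA : CodeFP (pairE eσ natE) (pairE (rawE natE) (pairE natE (pairE natE (pairE (rawE clopE) (pairE (rawE natE) (rawE natE))))))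
      (fun q => (had q.1, (cr q.1, (t q.1 q.2, (gops q.1 q.2, (([] : List ℕ), [flag q.1 q.2])))))) :=
    (hhad.comp (fst _ _)).pair ((hcr.comp (fst _ _)).pair (ht.pair (hgops.pair h6)))
  have hS : CodeFP (pairE eσ natE) (rawE agE0) (fun q => sandwichA (had q.1) (cr q.1) (t q.1 q.2) (gops q.1 q.2) [] [flag q.1 q.2]) :=
    (sandwichA_fp.comp hA).congr fun _ => rfl
  have hB : CodeFP (pairE eσ natE) (pairE natE (pairE (rawE natE) (rawE natE))) (fun q => (cr q.1, (asreg q.1, hs q.1))) :=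
    (hcr.comp (fst _ _)).pair ((hasreg.comp (fst _ _)).pair (hhs.comp (fst _ _)))
  have hR : CodeFP (pairE eσ natE) (rawE agE0) (fun q => reflectA (cr q.1) (asreg q.1) (hs q.1)) :=
    (reflectA_fp.comp hB).congr fun _ => rfl
  exact (oaaWordA_fp.comp (hS.pair hR)).congr fun _ => rfl

/-- **The Grover–Rudolph block's word on codes** (the shape of `GRStageAbstract.map_toAG_blockCircuit`, with
`List.range`): level `j < ℓ` is the placed clean block's word on `j + np` data wires with suffix `v j`, the rotation
word, and the reversed placed program's word. [cite: Regev2009, Lemma 3.12 (proof), Lemma 3.14 (proof)]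
[cite: AroraBarak2009, §6.2 and proof of Thm. 6.15] -/
theorem levelsA_codeFP_of {ℓ np base cr : σ → ℕ} {v : σ → ℕ → List Bool} {dpos : σ → ℕ → ℕ → ℕ} {t flag : σ → ℕ → ℕ}
    {gops : σ → ℕ → List (ClOp ℕ)} {had asreg hs : σ → List ℕ}
    (hℓ : CodeFP eσ unE ℓ) (hnp : CodeFP eσ natE np) (hbase : CodeFP eσ natE base) (hcr : CodeFP eσ natE cr)
    (hv : CodeFP (pairE eσ natE) strE (fun q => v q.1 q.2))
    (hN : CodeFP (pairE eσ natE) unE (fun q => q.2 + np q.1 + (v q.1 q.2).length))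
    (hdpos : CodeFP (pairE (pairE eσ natE) natE) natE (fun q => dpos q.1.1 q.1.2 q.2))
    (ht : CodeFP (pairE eσ natE) natE (fun q => t q.1 q.2)) (hflag : CodeFP (pairE eσ natE) natE (fun q => flag q.1 q.2))
    (hgops : CodeFP (pairE eσ natE) (rawE clopE) (fun q => gops q.1 q.2)) (hhad : CodeFP eσ (rawE natE) had)
    (hasreg : CodeFP eσ (rawE natE) asreg) (hhs : CodeFP eσ (rawE natE) hs) :
    CodeFP eσ (rawE agE0) (fun c => (List.range (ℓ c)).flatMap fun j =>
      progA ((cleanOps e M (j + np c) (v c j)).map (ClOp.map (relabel (j + np c) (dpos c j) (base c)))) ++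
        (oaaWordA (sandwichA (had c) (cr c) (t c j) (gops c j) [] [flag c j]) (reflectA (cr c) (asreg c) (hs c)) ++
          progA ((cleanOps e M (j + np c) (v c j)).map (ClOp.map (relabel (j + np c) (dpos c j) (base c)))).reverse)) := by
  have hn₀ : CodeFP (pairE eσ natE) natE (fun q => q.2 + np q.1) := natAdd.comp ((snd _ _).pair (hnp.comp (fst _ _)))
  have hP := CleanXor.placedWordA_codeFP_of (e := e) (M := M) (σ := σ × ℕ) (n₀ := fun q => q.2 + np q.1) (v := fun q => v q.1 q.2)
    (dpos := fun q i => dpos q.1 q.2 i) (base := fun q => base q.1) hn₀ hv hN (hbase.comp (fst _ _)) hdpos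
  have hR := CleanXor.placedRevWordA_codeFP_of (e := e) (M := M) (σ := σ × ℕ) (n₀ := fun q => q.2 + np q.1) (v := fun q => v q.1 q.2)
    (dpos := fun q i => dpos q.1 q.2 i) (base := fun q => base q.1) hn₀ hv hN (hbase.comp (fst _ _)) hdpos
  have hW := rotWordA_codeFP_of hcr ht hflag hgops hhad hasreg hhs
  exact UExec.flatMapRange hℓ (agAppend hP (agAppend hW hR))

end GRStage

end Literature.Computability.QuantumComplexity

end
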